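import Summits.QuantumFields.YangMills.Theorems.BalabanUVNodesN15KingModelBoxGreenDiagonal
import HarnessLib

/-!
# BalabanUVNodes ∕ N15 — THE KING-MODEL RUNG (PART Ϟ-o): ONE-SIDED COMPARISONS BETWEEN FREE AND PERIODIC BOUNDARY CONDITIONS —
# `|Ω|⁻¹·ln det(c(−Δ_free)+m²)_Ω ≤ |T̂(2n)|⁻¹·ln det(c(−Δ)+m²)_{Πℤ∕2n_μ}` (the shifted half-grid sums DOMINATE the unshifted one: the symbol increases along each
# coordinate of `[0,π]^{d+1}`), and `G_{T(2n)}(0,0) ≤ G^Ω(s,s) ≤ 2^{d+1}G_{T(2n)}(0,0)` at EVERY site (the free-boundary variance dominates the periodic one)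
# (Track A, DAG node N15 = NE2; FAN-OUT v1.1 §N15 s3 «KING-MODEL RUNG»; King p.670 l.8–13; count-neutral)

HONEST FRAMING.  Count-neutral (cell `pub-ymgap`, seat `pub-ymgap-dag-n15-e` g41; `--supports stmt-QuantumFields-27366 --as helper` = K3⁸).
TEMPLATE LITERATURE: C. King, Commun. Math. Phys. **102** (1986) 649–677 [King1986]: (2.13)∕(2.17) p.653, (3.89) p.668, (4.4) p.670, §4 p.670 l.8–13.  Parts Ϟ-e∕Ϟ-g wrote both
densities through the shifted half-grid sums `boxLogSymSum S` and bounded their difference in absolute value; part Ν-a′ proved `B⁻¹_{T(2n)}(dbl s, dbl t) ≤ G^Ω(s,t)` (the direct image is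
a lower bound).  THIS FILE records the SIGNS: §1 `kingLogSym_mono` (the free log-symbol is monotone in each coordinate on `[0,π]`), ★ `boxLogSymSum_empty_le` (`boxLogSymSum ∅ ≤ boxLogSymSum S`),
★★★ **`log_det_boxOp_div_card_le_dbl_torus`** (`|Ω|⁻¹ln det(c(−Δ_free)+m²)_Ω ≤ |T̂(2n)|⁻¹ln det(c(−Δ)+m²)_{T(2n)}`: the periodic free energy density of the doubled torus DOMINATES the
free-boundary one), ★★ `log_gaussNorm_boxOp_div_card_ge_dbl_torus` (equivalently the normalisation per site: `|T̂(2n)|⁻¹ln 𝒩_{T(2n)} ≤ |Ω|⁻¹ln 𝒩_Ω`); §2 ★★ **`lapF_dbl_inv_diag_le_kingBoxGreen_diag`**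
(`G_{T(2n)}(0,0) ≤ G^Ω(s,s)` at every site — free boundary conditions INCREASE every variance), ★ `kingBoxGreen_diag_le` (`G^Ω(s,s) ≤ 2^{d+1}·G_{T(2n)}(0,0)`), ★ `avg_kingBoxGreen_diag_ge`
(`G_{T(2n)}(0,0) ≤ |Ω|⁻¹Σ_sG^Ω(s,s)` — the sign behind Ϟ-m's rate).

PRIOR TREE ART (named, USED not restated): Ϟ-e (`boxLogSymSum`, `sum_log_lapSym_dblTorus_eq`, `log_det_boxOp_eq_boxLogSymSum`, `card_kingBox`), Ε-m (`kingLogSym`), Ε-k (`log_det_lapF`),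
Ε-e (`lapF_inv_diag_eq`), Ν-a′∕Ν-b (`kingBoxGreen`, `lapF_inv_dblBox_le_kingBoxGreen`, `card_dblTorus_eq`), Ϟ-c (`log_gaussNorm_boxOp`), Ε-p (`log_gaussNorm_lapF`), `King1986` (`lapSym`,
`lapF_inv_nonneg` via `ProperTime`).  NOT Bałaban's covariant objects; NOT a node discharge (N15 is booked through n15-a's knit, untouched); nothing continuum-YM ∕ `ℝ⁴` ∕ OS ∕ Clay.
0 `sorry`; 0 `def`.

HONEST SCOPE.  King's `A = 0` free operator, `c ≥ 0`, `m² > 0`; the comparison torus is the DOUBLED torus `Πℤ∕2n_μ`.  No statement about the sign of `|T|⁻¹ln det − kingFreeEnergyInf`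
(that would need the sign of the lattice Fourier coefficients of the log-symbol).  Locators: [King1986] (2.13)∕(2.17) p.653, (3.89) p.668, (4.4) p.670, §4 p.670 l.8–13.
-/

noncomputable section

open scoped BigOperators
open Finset Matrix

namespace Summit.QuantumFields.YangMills.BalabanUVNodes.N15KingModelRung.TorusSpectral

open Literature.MathematicalPhysics.QuantumFieldTheory.Balaban1983to89.B5Prop11Plancherel (Tor)
open Literature.MathematicalPhysics.QuantumFieldTheory.King1986.Torus
open Summit.QuantumFields.YangMills.BalabanUVNodes.N15KingModelRung.FreeField (gaussNorm)
open Summit.QuantumFields.YangMills.BalabanUVNodes.N15KingModelRung.ProperTime (lapF_inv_nonneg)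

variable {d : ℕ}

/-! ## §1 The periodic free energy density dominates the free-boundary one -/

section Density

variable {c m2 : ℝ}

/-- the free log-symbol is monotone in each coordinate on `[0,π]`: `0 ≤ p_μ ≤ p′_μ ≤ π ⇒ kingLogSym p ≤ kingLogSym p′` (`cos` decreases on `[0,π]`, `c ≥ 0`, `m² > 0`).
[cite: King1986, (4.4) p.670] -/
theorem kingLogSym_mono (hc : 0 ≤ c) (hm : 0 < m2) {p p' : Fin (d + 1) → ℝ} (h0 : ∀ μ, 0 ≤ p μ) (hle : ∀ μ, p μ ≤ p' μ) (hπ : ∀ μ, p' μ ≤ Real.pi) :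
    kingLogSym c m2 p ≤ kingLogSym c m2 p' := by
  unfold kingLogSym
  have hS : ∀ q : Fin (d + 1) → ℝ, 0 ≤ c * ∑ μ, (2 - 2 * Real.cos (q μ)) := fun q =>
    mul_nonneg hc (Finset.sum_nonneg fun μ _ => by linarith [Real.cos_le_one (q μ)])
  refine Real.log_le_log (by linarith [hS p]) ?_
  refine add_le_add le_rfl (mul_le_mul_of_nonneg_left (Finset.sum_le_sum fun μ _ => ?_) hc)
  have := Real.cos_le_cos_of_nonneg_of_le_pi (h0 μ) (hπ μ) (hle μ)
  linarith

variable (n : Fin (d + 1) → ℕ) [hn : ∀ μ, NeZero (n μ)]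

/-- ★ **THE SHIFTED HALF-GRID SUMS DOMINATE THE UNSHIFTED ONE**: `boxLogSymSum ∅ ≤ boxLogSymSum S` for every `S`. [cite: King1986, (4.4) p.670, §4 p.670] -/
theorem boxLogSymSum_empty_le (hc : 0 ≤ c) (hm : 0 < m2) (S : Finset (Fin (d + 1))) : boxLogSymSum n c m2 ∅ ≤ boxLogSymSum n c m2 S := by
  unfold boxLogSymSum
  refine Finset.sum_le_sum fun k _ => kingLogSym_mono hc hm (fun μ => ?_) (fun μ => ?_) (fun μ => ?_)
  · simp only [Finset.notMem_empty, if_false, add_zero]; positivity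
  · simp only [Finset.notMem_empty, if_false, add_zero]
    have hn0 : (0 : ℝ) < n μ := by exact_mod_cast NeZero.pos (n μ)
    apply div_le_div_of_nonneg_right _ hn0.le
    apply mul_le_mul_of_nonneg_left _ Real.pi_pos.le
    split_ifs <;> linarith
  · have hn0 : (0 : ℝ) < n μ := by exact_mod_cast NeZero.pos (n μ)
    have hk : ((k μ).val : ℝ) + 1 ≤ n μ := by exact_mod_cast (k μ).isLt
    rw [div_le_iff₀ hn0]
    have : ((k μ).val : ℝ) + (if μ ∈ S then (1 : ℝ) else 0) ≤ n μ := by split_ifs <;> linarith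
    nlinarith [Real.pi_pos]

/-- ★★★ **THE PERIODIC FREE ENERGY DENSITY DOMINATES THE FREE-BOUNDARY ONE**: `|Ω|⁻¹·ln det(c(−Δ_free)+m²)_Ω ≤ |T̂(2n)|⁻¹·ln det(c(−Δ)+m²)_{Πℤ∕2n_μ}` (`c ≥ 0`, `m² > 0`, every box).
[cite: King1986, (3.89) p.668, (4.4) p.670, §4 p.670 l.8–13] -/
theorem log_det_boxOp_div_card_le_dbl_torus (hc : 0 ≤ c) (hm : 0 < m2) :
    (Fintype.card (KingBox n) : ℝ)⁻¹ * Real.log (boxOp n c m2).det ≤ (Fintype.card (Tor (dblPer n)) : ℝ)⁻¹ * Real.log (lapF (dblPer n) c m2).det := by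
  have hP : (0 : ℝ) < ∏ ν, (n ν : ℝ) := Finset.prod_pos fun ν _ => by exact_mod_cast NeZero.pos (n ν)
  have h2 : (0 : ℝ) < 2 ^ (d + 1) := by positivity
  rw [log_det_lapF (dblPer n) hc hm, sum_log_lapSym_dblTorus_eq n c m2, log_det_boxOp_eq_boxLogSymSum n hc hm, card_dblTorus_eq n, card_kingBox n]
  push_cast
  have hsum : (2 : ℝ) ^ (d + 1) * boxLogSymSum n c m2 ∅ ≤ ∑ S : Finset (Fin (d + 1)), boxLogSymSum n c m2 S := by
    calc (2 : ℝ) ^ (d + 1) * boxLogSymSum n c m2 ∅ = ∑ _S : Finset (Fin (d + 1)), boxLogSymSum n c m2 ∅ := by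
          rw [Finset.sum_const, Finset.card_univ, Fintype.card_finset, Fintype.card_fin, nsmul_eq_mul]; push_cast; ring
      _ ≤ _ := Finset.sum_le_sum fun S _ => boxLogSymSum_empty_le n hc hm S
  rw [mul_inv, inv_mul_le_iff₀ hP, ← mul_assoc, ← mul_assoc, mul_comm (∏ ν, (n ν : ℝ)), mul_assoc _ _ (∏ ν, (n ν : ℝ))⁻¹, mul_inv_cancel₀ hP.ne', mul_one,
    le_inv_mul_iff₀ h2]
  exact hsum

/-- ★★ equivalently for the Gaussian normalisations per site: `|T̂(2n)|⁻¹·ln 𝒩((c(−Δ)+m²)_{T(2n)}) ≤ |Ω|⁻¹·ln 𝒩((c(−Δ_free)+m²)_Ω)`. [cite: King1986, (3.89) p.668, (2.6) p.652, §4 p.670] -/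
theorem log_gaussNorm_boxOp_div_card_ge_dbl_torus (hc : 0 ≤ c) (hm : 0 < m2) :
    (Fintype.card (Tor (dblPer n)) : ℝ)⁻¹ * Real.log (gaussNorm (lapF (dblPer n) c m2)) ≤ (Fintype.card (KingBox n) : ℝ)⁻¹ * Real.log (gaussNorm (boxOp n c m2)) := by
  have hT0 : (Fintype.card (Tor (dblPer n)) : ℝ) ≠ 0 := by exact_mod_cast Fintype.card_ne_zero
  have hΩ0 : (Fintype.card (KingBox n) : ℝ) ≠ 0 := by exact_mod_cast Fintype.card_ne_zero
  have h := log_det_boxOp_div_card_le_dbl_torus n hc hm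
  rw [log_gaussNorm_lapF (dblPer n) hc hm, log_gaussNorm_boxOp n hc hm, ← log_det_lapF (dblPer n) hc hm, ← log_det_boxOp n hc hm, mul_sub, mul_sub,
    show ((Fintype.card (Tor (dblPer n)) : ℝ))⁻¹ * ((Fintype.card (Tor (dblPer n)) : ℝ) / 2 * Real.log (2 * Real.pi)) = 1 / 2 * Real.log (2 * Real.pi) by
      rw [div_eq_mul_inv, ← mul_assoc, ← mul_assoc, inv_mul_cancel₀ hT0, one_mul]; ring,
    show ((Fintype.card (KingBox n) : ℝ))⁻¹ * ((Fintype.card (KingBox n) : ℝ) / 2 * Real.log (2 * Real.pi)) = 1 / 2 * Real.log (2 * Real.pi) by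
      rw [div_eq_mul_inv, ← mul_assoc, ← mul_assoc, inv_mul_cancel₀ hΩ0, one_mul]; ring]
  nlinarith [h]

end Density

/-! ## §2 Free boundary conditions increase every variance -/

section Variance

variable (n : Fin (d + 1) → ℕ) [hn : ∀ μ, NeZero (n μ)] {c m2 : ℝ}

/-- ★★ **FREE BOUNDARY CONDITIONS INCREASE EVERY VARIANCE**: `G_{T(2n)}(0,0) ≤ G^Ω(s,s)` at every site `s ∈ Ω` (the direct image is one of the `2^{d+1}` non-negative images; the
torus diagonal is constant by translation invariance). [cite: King1986, (2.17) p.653, §4 p.670 l.8–13] -/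
theorem lapF_dbl_inv_diag_le_kingBoxGreen_diag (hc : 0 ≤ c) (hm : 0 < m2) (s : KingBox n) :
    (lapF (dblPer n) c m2)⁻¹ 0 0 ≤ kingBoxGreen n c m2 s s := by
  have hdiag : (lapF (dblPer n) c m2)⁻¹ 0 0 = (lapF (dblPer n) c m2)⁻¹ (dblBox n s) (dblBox n s) := by
    rw [lapF_inv_diag_eq (dblPer n) hc hm, lapF_inv_diag_eq (dblPer n) hc hm]
  rw [hdiag]
  exact lapF_inv_dblBox_le_kingBoxGreen n hc hm s s

/-- ★ **… BY AT MOST THE FACTOR `2^{d+1}`**: `G^Ω(s,s) ≤ 2^{d+1}·G_{T(2n)}(0,0)` (each image of the coincident point is bounded by the torus diagonal, Cauchy–Schwarz-free: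
`B⁻¹(x,y) ≤ B⁻¹(0,0)` for the positive-definite translation-invariant torus covariance). [cite: King1986, (2.17) p.653, §4 p.670] -/
theorem kingBoxGreen_diag_le (hc : 0 ≤ c) (hm : 0 < m2) (s : KingBox n) :
    kingBoxGreen n c m2 s s ≤ 2 ^ (d + 1) * (lapF (dblPer n) c m2)⁻¹ 0 0 := by
  unfold kingBoxGreen
  have hterm : ∀ S : Finset (Fin (d + 1)), (lapF (dblPer n) c m2)⁻¹ (dblBox n s) (torReflS (dblPer n) S (dblBox n s)) ≤ (lapF (dblPer n) c m2)⁻¹ 0 0 := by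
    intro S
    exact (abs_lapF_inv_le_diag (dblPer n) hc hm (dblBox n s) (torReflS (dblPer n) S (dblBox n s))).trans (le_of_eq (by rw [lapF_inv_diag_eq (dblPer n) hc hm, lapF_inv_diag_eq (dblPer n) hc hm]))
      |> (le_abs_self _).trans
  calc ∑ S : Finset (Fin (d + 1)), (lapF (dblPer n) c m2)⁻¹ (dblBox n s) (torReflS (dblPer n) S (dblBox n s))
      ≤ ∑ _S : Finset (Fin (d + 1)), (lapF (dblPer n) c m2)⁻¹ 0 0 := Finset.sum_le_sum fun S _ => hterm S
    _ = 2 ^ (d + 1) * (lapF (dblPer n) c m2)⁻¹ 0 0 := by rw [Finset.sum_const, Finset.card_univ, Fintype.card_finset, Fintype.card_fin, nsmul_eq_mul]; push_cast; ring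

/-- ★ the averaged version: `G_{T(2n)}(0,0) ≤ |Ω|⁻¹Σ_sG^Ω(s,s)` — the sign behind Ϟ-m's two-sided rate. [cite: King1986, (2.17) p.653, §4 p.670] -/
theorem avg_kingBoxGreen_diag_ge (hc : 0 ≤ c) (hm : 0 < m2) :
    (lapF (dblPer n) c m2)⁻¹ 0 0 ≤ (Fintype.card (KingBox n) : ℝ)⁻¹ * ∑ s : KingBox n, kingBoxGreen n c m2 s s := by
  have hcard : (0 : ℝ) < Fintype.card (KingBox n) := by exact_mod_cast Fintype.card_pos
  rw [le_inv_mul_iff₀ hcard]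
  calc (Fintype.card (KingBox n) : ℝ) * (lapF (dblPer n) c m2)⁻¹ 0 0 = ∑ _s : KingBox n, (lapF (dblPer n) c m2)⁻¹ 0 0 := by
        rw [Finset.sum_const, Finset.card_univ, nsmul_eq_mul]
    _ ≤ _ := Finset.sum_le_sum fun s _ => lapF_dbl_inv_diag_le_kingBoxGreen_diag n hc hm s

end Variance

end Summit.QuantumFields.YangMills.BalabanUVNodes.N15KingModelRung.TorusSpectral

end
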